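import Summits.MatrixMultiplication.MatrixMultiplication.Theorems.FarEdgeDescentTowerEleven
import Summits.MatrixMultiplication.Statement
import Literature.Computability.AlgebraicComplexity.RectangularExponent
import Literature.Computability.AlgebraicComplexity.RectangularExponentSubadditivity
import Literature.Computability.AlgebraicComplexity.RectangularExponentAlpha
import HarnessLib

/-!
# Route `FarEdgeDescent` — the rate–transport dial (kernel XXV-b)

decomp-mm ROOT cell (D-0178), lens 2 «structural dichotomy: special vs generic», gen 49.  THESES-FREE and
definition-free (imports `Literature`, the summit `Statement` and the theses-free kernel XXV-a only).
`e(x) := ω(1,x,1) − (x+1) ≥ 0` on the REAL shape axis (`ω(1,x,1) = omegaRect K 1 x 1`).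

THE DIAL.  For a real parameter `θ ≥ 0` put (spelled out inline below, no `def`s)
* `RateBeyond θ  := ∃ δ C, θ < δ ∧ ∀ k : ℕ, 1 ≤ k → e(k) ≤ C·k^{−δ}` — the SPECIAL piece: a power-law rate of the
  far-edge excess with exponent BEYOND `θ` (at `θ = 0` it is literally the route item `PowerAmortisation`,
  stmt-MatrixMultiplication-25347, PROVED by kernel XXIV; kernel XXV-a proves it for every `θ < log 2/log 11`);
* `SquareTransport θ := ∀ m : ℝ, 1 < m → e(m) ≤ 2^θ · e(2m−1)` — the GENERIC piece: a FIXED-RATIO transport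
  of the excess along the square-anchored doubling `m ↦ 2m−1` (the linear relaxation, by the factor `2^θ`,
  of the shape of the asides `BoundedDoublingDefect` 26556 / `AnchoredLogConvexity` 28900; never evaluates a
  shape below the square).
THEOREMS (every field `K`; `S_K :≡ ω_K = 2`, `S_ℂ` = the summit `MatrixMultiplication`):
(1) `dial_iff`: `S_K ↔ RateBeyond θ ∧ SquareTransport θ` for every `θ ≥ 0` — sufficiency by the REAL-AXIS
    DESCENT `m_j = 1 + (k−1)/2^j` (`2m_{j+1} − 1 = m_j`): on the grid `k = 2^J + 1` the descent lands on the
    shape `2`, `e(2) ≤ 2^{θJ}·e(2^J+1) ≤ C·2^{(θ−δ)J} → 0`, so `e(2) = 0`; then `e(1 + 2^{−n}) = 0` and the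
    SQUARE FLOOR `(ω−2)·k ≤ (k−1) + e(k)` (Lotti–Romani convexity on `[0,k]`, anchor `ω(1,0,1) = 2`) gives
    `ω − 2 ≤ 2^{−n}`; necessity since `S_K ⇒ e ≡ 0` on `[1,∞)`;  `matrixMultiplication_iff_dial` (over `ℂ`).
(2) PINNED END (costume certificate): for `0 ≤ θ < log 2/log 11 = 0.28906…` the special piece is a THEOREM
    (kernel XXV-a `rateBeyond_of_lt_trueOrder`), hence `SquareTransport θ ↔ S_K`
    (`squareTransport_iff_of_lt_trueOrder`): below the proved rate exponent the generic piece is summit-strength.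
(3) RATCHET: `SquareTransport` is monotone in `θ` (`squareTransport_mono`) — every gain of the special leaf
    (a larger proved exponent) converts the old generic piece into costume and WEAKENS the new one.
(4) HONESTY: `SquareTransport θ ∧ ω > 2 ⇒ e(2) > 0` and `e(2^J+1) ≥ 2^{−θJ}·e(2)` (`excess_two_pos_of_…`,
    `transport_descent`): the generic piece alone forces a polynomial FLOOR of order `θ` on the grid — exactly the
    complement of `RateBeyond θ`.
(5) WORLDS (strictly-weaker evidence, abstract profiles): `E(x) = c·x^{−θ}` (`c > 0`) satisfies the transport
    law with factor `2^θ`, has `E(1) = c ≠ 0` and violates every rate beyond `θ` (`world_power_…`); the kink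
    `E(x) = max 0 (c(2−x))` satisfies every rate, has `E(1) = c ≠ 0` and violates the transport law for every
    `θ` (`world_kink`).  So at the featured position `θ* = log 2/log 11` (the ceiling of the one-anchor tower family,
    kernel XXV-a) both pieces are necessary, independent and — in the world sense, consistent with every excess
    bound of the tree (`e(k) ≤ 33^{θ*}k^{−θ*}`) for `c ≤ 1` — strictly weaker than `S`.
Why this is new (cell memo NODE-g49; search-before-claim in the lineage census): the cell's earlier dials were
MULTIPLICATIVE (log-convexity / doubling defects, items 23738, 26556, 27702, 28900 — contact with `S` only through
`exp(−cK)`-small excess, gens 18–20) or INTEGER-OCTAVE at `δ = 1` (route `OctaveBudget`, items 25355/26289 with the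
square link 23740); this dial is LINEAR with a free exponent, lives on the real axis (no square link: the descent
closes AT the square by a theorem), and its special leaf is a proved-and-improvable POLYNOMIAL rate.
NO definitions (gate rule D-0009).
[cite: LottiRomani1983, §1 (p. 173), §2 (p. 174), Prop. 4.1] [cite: ChristandlLeGallLysikovZuiddam2025, Rem. 3.13]
[cite: CoppersmithWinograd1982, Thm. 1]
-/

set_option linter.dupNamespace false

noncomputable section

namespace Summit.MatrixMultiplication.MatrixMultiplication.Theorems.FarEdgeDescentRateTransportDial

open Filter Topology
open Literature.Computability.AlgebraicComplexity
open Summit.MatrixMultiplication.MatrixMultiplication.Theorems.FarEdgeDescentTowerEleven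

variable (K : Type) [Field K]

/-! ## §1 Descent and floor -/

/-- **Real-axis descent.**  A transport law `e(m) ≤ l·e(2m−1)` (`m > 1`, `l ≥ 0`) iterates along
`m_n = 1 + (k−1)/2^n` (`2m_{n+1} − 1 = m_n`): `e(m_n) ≤ l^n·e(k)` for every real `k > 1`.
[cite: LottiRomani1983, §2 (p. 174)] -/
theorem transport_descent {l : ℝ} (hl : 0 ≤ l)
    (hT : ∀ m : ℝ, 1 < m →
      omegaRect K 1 m 1 - (m + 1) ≤ l * (omegaRect K 1 (2 * m - 1) 1 - 2 * m))
    {k : ℝ} (hk : 1 < k) (n : ℕ) :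
    omegaRect K 1 (1 + (k - 1) / 2 ^ n) 1 - ((1 + (k - 1) / 2 ^ n) + 1) ≤
      l ^ n * (omegaRect K 1 k 1 - (k + 1)) := by
  induction n with
  | zero =>
    have e : 1 + (k - 1) / 2 ^ 0 = k := by rw [pow_zero, div_one]; ring
    rw [e, pow_zero, one_mul]
  | succ n ih =>
    have hpos : 0 < (k - 1) / 2 ^ (n + 1) := div_pos (by linarith) (pow_pos two_pos _)
    have h := hT (1 + (k - 1) / 2 ^ (n + 1)) (by linarith)
    have e1 : 2 * (1 + (k - 1) / 2 ^ (n + 1)) - 1 = 1 + (k - 1) / 2 ^ n := by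
      rw [pow_succ]; field_simp; ring
    have e2 : 2 * (1 + (k - 1) / 2 ^ (n + 1)) = (1 + (k - 1) / 2 ^ n) + 1 := by linarith
    rw [e1] at h
    rw [e2] at h
    calc _ ≤ l * (omegaRect K 1 (1 + (k - 1) / 2 ^ n) 1 - ((1 + (k - 1) / 2 ^ n) + 1)) := h
      _ ≤ l * (l ^ n * (omegaRect K 1 k 1 - (k + 1))) := mul_le_mul_of_nonneg_left ih hl
      _ = l ^ (n + 1) * (omegaRect K 1 k 1 - (k + 1)) := by rw [pow_succ]; ring

/-- **Square floor.**  `(ω − 2)·k ≤ (k − 1) + e(k)` for every real `k ≥ 1`: Lotti–Romani convexity of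
`x ↦ ω(1,x,1)` on `[0,k]` with the anchors `ω(1,0,1) = 2`, `ω(1,1,1) = ω` (weights `1 − 1/k`, `1/k`).
[cite: LottiRomani1983, §1 (p. 173)] -/
theorem square_floor {k : ℝ} (hk : 1 ≤ k) :
    (omega K - 2) * k ≤ (k - 1) + (omegaRect K 1 k 1 - (k + 1)) := by
  have hk0 : 0 < k := by linarith
  have ha : 0 ≤ 1 - 1 / k := by rw [sub_nonneg, div_le_one hk0]; exact hk
  have hb : (0 : ℝ) ≤ 1 / k := by positivity
  have h := LottiRomani1983_convexComb_le K (x := 1) (y := 0) (z := 1) (x' := 1) (y' := k) (z' := 1)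
    (a := 1 - 1 / k) (b := 1 / k) zero_le_one le_rfl zero_le_one zero_le_one hk0.le zero_le_one ha hb
  have e1 : (1 - 1 / k) * 1 + 1 / k * 1 = (1 : ℝ) := by ring
  have e2 : (1 - 1 / k) * 0 + 1 / k * k = (1 : ℝ) := by
    rw [mul_zero, zero_add, one_div, inv_mul_cancel₀ hk0.ne']
  rw [e1, e2, omegaRect_one_one_one, omegaRect_one_zero_one] at h
  have e3 : (1 - 1 / k) * 2 + 1 / k * omegaRect K 1 k 1 = 2 + (omegaRect K 1 k 1 - 2) / k := by
    field_simp; ring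
  rw [e3] at h
  have h' : omega K - 2 ≤ (omegaRect K 1 k 1 - 2) / k := by linarith
  rw [le_div_iff₀ hk0] at h'
  linarith

/-- `e ≥ 0` and `ω ≥ 2` (information bounds). [cite: Blaser2013, Lemma 7.1 (2)] -/
theorem excess_nonneg_and_two_le_omega (x : ℝ) :
    0 ≤ omegaRect K 1 x 1 - (x + 1) ∧ 2 ≤ omega K := by
  refine ⟨by linarith [add_one_le_omegaRect_one_mid_one K x], ?_⟩
  have h := add_one_le_omegaRect_one_mid_one K 1
  rw [omegaRect_one_one_one] at h
  linarith

/-! ## §2 The generic piece closes from `e(2) = 0`; the dial closes -/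

/-- **Stages 2–3 of the descent.**  A transport law with any factor `l ≥ 0` and `e(2) ≤ 0` give `ω = 2`:
`e(1 + 2^{−n}) ≤ l^n·e(2) ≤ 0`, and the square floor at `k = 1 + 2^{−n}` gives `ω − 2 ≤ 2^{−n}`.
[cite: LottiRomani1983, §1 (p. 173), §2 (p. 174)] -/
theorem omega_eq_two_of_transport_of_excess_two_nonpos {l : ℝ} (hl : 0 ≤ l)
    (hT : ∀ m : ℝ, 1 < m →
      omegaRect K 1 m 1 - (m + 1) ≤ l * (omegaRect K 1 (2 * m - 1) 1 - 2 * m))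
    (h2 : omegaRect K 1 2 1 - (2 + 1) ≤ 0) : omega K = 2 := by
  obtain ⟨-, hω⟩ := excess_nonneg_and_two_le_omega K 0
  -- `ω − 2 ≤ 2^{−n}` for every `n`
  have hsmall : ∀ n : ℕ, omega K - 2 ≤ 1 / (2 : ℝ) ^ n := by
    intro n
    have hd := transport_descent K hl hT (k := 2) (by norm_num) n
    have e : 1 + ((2 : ℝ) - 1) / 2 ^ n = 1 + 1 / (2 : ℝ) ^ n := by norm_num
    rw [e] at hd
    have hz : omegaRect K 1 (1 + 1 / (2 : ℝ) ^ n) 1 - ((1 + 1 / (2 : ℝ) ^ n) + 1) ≤ 0 :=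
      hd.trans (mul_nonpos_of_nonneg_of_nonpos (pow_nonneg hl n) h2)
    have ht : (0 : ℝ) < 1 / 2 ^ n := by positivity
    have hf := square_floor K (k := 1 + 1 / (2 : ℝ) ^ n) (by linarith)
    nlinarith
  have hle : omega K ≤ 2 := by
    by_contra hlt
    rw [not_le] at hlt
    obtain ⟨n, hn⟩ := exists_pow_lt_of_lt_one (by linarith : 0 < omega K - 2)
      (by norm_num : (1 / 2 : ℝ) < 1)
    have h := hsmall n
    rw [one_div_pow] at hn
    linarith
  exact le_antisymm hle hω

/-- **The dial closes** (every field, every `θ ≥ 0`): `RateBeyond θ ∧ SquareTransport θ ⇒ ω = 2`.  Stage 1 on the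
grid `k = 2^J + 1`: the descent from `k` lands on the shape `2` after `J` steps, so
`0 ≤ e(2) ≤ 2^{θJ}·C·(2^J+1)^{−δ} ≤ C·(2^{θ−δ})^J → 0`; then `omega_eq_two_of_transport_of_excess_two_nonpos`.
[cite: LottiRomani1983, §1–§2, Prop. 4.1] -/
theorem omega_eq_two_of_rateBeyond_of_squareTransport {θ : ℝ} (hθ : 0 ≤ θ)
    (hR : ∃ δ C : ℝ, θ < δ ∧ ∀ k : ℕ, 1 ≤ k →
      omegaRect K 1 k 1 - (k + 1) ≤ C * (k : ℝ) ^ (-δ))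
    (hT : ∀ m : ℝ, 1 < m →
      omegaRect K 1 m 1 - (m + 1) ≤ (2 : ℝ) ^ θ * (omegaRect K 1 (2 * m - 1) 1 - 2 * m)) :
    omega K = 2 := by
  obtain ⟨δ, C, hθδ, hrate⟩ := hR
  have h2θ : 0 < (2 : ℝ) ^ θ := Real.rpow_pos_of_pos two_pos θ
  have hC : 0 ≤ C := by
    have h1 := hrate 1 le_rfl
    have h0 := (excess_nonneg_and_two_le_omega K 1).1
    norm_num at h1 h0 ⊢
    linarith
  set r : ℝ := (2 : ℝ) ^ (θ - δ) with hr
  have hr1 : r < 1 := Real.rpow_lt_one_of_one_lt_of_neg (by norm_num) (by linarith)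
  -- Stage 1: `e(2) ≤ C·r^J` for every `J`
  have stage1 : ∀ J : ℕ, omegaRect K 1 2 1 - (2 + 1) ≤ C * r ^ J := by
    intro J
    have hk1 : (1 : ℝ) < ((2 ^ J + 1 : ℕ) : ℝ) := by
      push_cast; linarith [pow_pos (two_pos : (0 : ℝ) < 2) J]
    have hd := transport_descent K h2θ.le hT hk1 J
    have e : 1 + (((2 ^ J + 1 : ℕ) : ℝ) - 1) / 2 ^ J = 2 := by
      push_cast; field_simp; ring
    rw [e] at hd
    have hk := hrate (2 ^ J + 1) (Nat.le_add_left 1 _)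
    have h2J : (0 : ℝ) < (2 : ℝ) ^ J := pow_pos two_pos J
    have hmono : (((2 ^ J + 1 : ℕ) : ℝ)) ^ (-δ) ≤ ((2 : ℝ) ^ J) ^ (-δ) :=
      Real.rpow_le_rpow_of_nonpos h2J (by push_cast; linarith) (by linarith)
    have epow : ((2 : ℝ) ^ J) ^ (-δ) = ((2 : ℝ) ^ (-δ)) ^ J := by
      rw [← Real.rpow_natCast_mul (by norm_num : (0 : ℝ) ≤ 2) J (-δ), mul_comm,
        Real.rpow_mul_natCast (by norm_num : (0 : ℝ) ≤ 2) (-δ) J]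
    have er : ((2 : ℝ) ^ θ) ^ J * ((2 : ℝ) ^ (-δ)) ^ J = r ^ J := by
      rw [← mul_pow, ← Real.rpow_add two_pos, hr, sub_eq_add_neg]
    calc omegaRect K 1 2 1 - (2 + 1)
        ≤ ((2 : ℝ) ^ θ) ^ J * (omegaRect K 1 ((2 ^ J + 1 : ℕ) : ℝ) 1 - (((2 ^ J + 1 : ℕ) : ℝ) + 1)) := hd
      _ ≤ ((2 : ℝ) ^ θ) ^ J * (C * (((2 ^ J + 1 : ℕ) : ℝ)) ^ (-δ)) :=
          mul_le_mul_of_nonneg_left hk (pow_nonneg h2θ.le J)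
      _ ≤ ((2 : ℝ) ^ θ) ^ J * (C * ((2 : ℝ) ^ J) ^ (-δ)) :=
          mul_le_mul_of_nonneg_left (mul_le_mul_of_nonneg_left hmono hC) (pow_nonneg h2θ.le J)
      _ = C * r ^ J := by rw [epow, ← er]; ring
  -- hence `e(2) ≤ 0`
  have hE2 : omegaRect K 1 2 1 - (2 + 1) ≤ 0 := by
    by_contra hpos
    rw [not_le] at hpos
    rcases le_or_gt C 0 with hC0 | hC0
    · have h := stage1 0
      rw [pow_zero, mul_one] at h
      linarith
    · have hr0 : 0 < r := Real.rpow_pos_of_pos two_pos _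
      obtain ⟨J, hJ⟩ := exists_pow_lt_of_lt_one (div_pos hpos hC0) hr1
      have h := stage1 J
      rw [lt_div_iff₀ hC0] at hJ
      linarith [mul_comm (r ^ J) C]
  exact omega_eq_two_of_transport_of_excess_two_nonpos K h2θ.le hT hE2

/-! ## §3 Necessity, the dial as an `iff`, the summit form -/

/-- `ω = 2 ⇒ e ≡ 0` on `[1, ∞)` (Lipschitz bound from the square and the information bound).
[cite: ChristandlLeGallLysikovZuiddam2025, Rem. 3.13] -/
theorem excess_eq_zero_of_omega_eq_two (h : omega K = 2) {x : ℝ} (hx : 1 ≤ x) :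
    omegaRect K 1 x 1 - (x + 1) = 0 := by
  have h1 := omegaRect_one_mid_one_le_add K hx
  rw [omegaRect_one_one_one, h] at h1
  have h2 := add_one_le_omegaRect_one_mid_one K x
  linarith

/-- **The dial** (every field, every `θ ≥ 0`): `ω = 2 ↔ RateBeyond θ ∧ SquareTransport θ`.
[cite: LottiRomani1983, §1–§2, Prop. 4.1] -/
theorem dial_iff {θ : ℝ} (hθ : 0 ≤ θ) :
    omega K = 2 ↔
      ((∃ δ C : ℝ, θ < δ ∧ ∀ k : ℕ, 1 ≤ k →
          omegaRect K 1 k 1 - (k + 1) ≤ C * (k : ℝ) ^ (-δ)) ∧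
        (∀ m : ℝ, 1 < m →
          omegaRect K 1 m 1 - (m + 1) ≤ (2 : ℝ) ^ θ * (omegaRect K 1 (2 * m - 1) 1 - 2 * m))) := by
  refine ⟨fun h => ⟨⟨θ + 1, 0, by linarith, fun k hk => ?_⟩, fun m hm => ?_⟩,
    fun h => omega_eq_two_of_rateBeyond_of_squareTransport K hθ h.1 h.2⟩
  · rw [excess_eq_zero_of_omega_eq_two K h (by exact_mod_cast hk), zero_mul]
  · rw [excess_eq_zero_of_omega_eq_two K h hm.le]
    have h0 := (excess_nonneg_and_two_le_omega K (2 * m - 1)).1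
    rw [show 2 * m - 1 + 1 = 2 * m by ring] at h0
    exact mul_nonneg (Real.rpow_nonneg zero_le_two θ) h0

/-- **Summit form of the dial**: `MatrixMultiplication ↔ RateBeyond θ ∧ SquareTransport θ` over `ℂ`, every
`θ ≥ 0` — a certified family of two-piece cuts of the summit (not filed as a route edit: OPS hold).
[cite: LottiRomani1983, Prop. 4.1] -/
theorem matrixMultiplication_iff_dial {θ : ℝ} (hθ : 0 ≤ θ) :
    _root_.MatrixMultiplication ↔
      ((∃ δ C : ℝ, θ < δ ∧ ∀ k : ℕ, 1 ≤ k →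
          omegaRect ℂ 1 k 1 - (k + 1) ≤ C * (k : ℝ) ^ (-δ)) ∧
        (∀ m : ℝ, 1 < m →
          omegaRect ℂ 1 m 1 - (m + 1) ≤ (2 : ℝ) ^ θ * (omegaRect ℂ 1 (2 * m - 1) 1 - 2 * m))) := by
  rw [_root_.MatrixMultiplication_iff]
  exact dial_iff ℂ hθ

/-! ## §4 Pinned end, ratchet, honesty -/

/-- **Pinned end (costume certificate).**  For `0 ≤ θ < log 2/log 11` the special piece is kernel XXV-a's theorem
`rateBeyond_of_lt_trueOrder`, so the generic piece ALONE is summit-strength: `SquareTransport θ ↔ ω = 2`.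
[cite: LottiRomani1983, Prop. 4.1] [cite: CoppersmithWinograd1982, Thm. 1] -/
theorem squareTransport_iff_of_lt_trueOrder {θ : ℝ} (hθ : 0 ≤ θ) (hθ' : θ < Real.log 2 / Real.log 11) :
    (∀ m : ℝ, 1 < m →
        omegaRect K 1 m 1 - (m + 1) ≤ (2 : ℝ) ^ θ * (omegaRect K 1 (2 * m - 1) 1 - 2 * m)) ↔
      omega K = 2 :=
  ⟨fun hT => omega_eq_two_of_rateBeyond_of_squareTransport K hθ (rateBeyond_of_lt_trueOrder K hθ') hT,
    fun h => ((dial_iff K hθ).1 h).2⟩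

/-- The same over `ℂ`, against the summit statement. [cite: LottiRomani1983, Prop. 4.1] -/
theorem squareTransport_iff_matrixMultiplication_of_lt_trueOrder {θ : ℝ} (hθ : 0 ≤ θ)
    (hθ' : θ < Real.log 2 / Real.log 11) :
    (∀ m : ℝ, 1 < m →
        omegaRect ℂ 1 m 1 - (m + 1) ≤ (2 : ℝ) ^ θ * (omegaRect ℂ 1 (2 * m - 1) 1 - 2 * m)) ↔
      _root_.MatrixMultiplication := by
  rw [_root_.MatrixMultiplication_iff]
  exact squareTransport_iff_of_lt_trueOrder ℂ hθ hθ'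

/-- **Ratchet.**  The generic piece is monotone in the dial: `θ ≤ θ' ⇒ SquareTransport θ ⇒ SquareTransport θ'`.
[cite: LottiRomani1983, §2 (p. 174)] -/
theorem squareTransport_mono {θ θ' : ℝ} (hθθ' : θ ≤ θ')
    (hT : ∀ m : ℝ, 1 < m →
      omegaRect K 1 m 1 - (m + 1) ≤ (2 : ℝ) ^ θ * (omegaRect K 1 (2 * m - 1) 1 - 2 * m)) :
    ∀ m : ℝ, 1 < m →
      omegaRect K 1 m 1 - (m + 1) ≤ (2 : ℝ) ^ θ' * (omegaRect K 1 (2 * m - 1) 1 - 2 * m) := by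
  intro m hm
  have h0 := (excess_nonneg_and_two_le_omega K (2 * m - 1)).1
  rw [show 2 * m - 1 + 1 = 2 * m by ring] at h0
  exact (hT m hm).trans (mul_le_mul_of_nonneg_right
    (Real.rpow_le_rpow_of_exponent_le (by norm_num) hθθ') h0)

/-- **Honesty.**  Under a transport law with factor `l ≥ 0`, `ω > 2` forces `e(2) > 0` — and then, by
`transport_descent` on the grid `k = 2^J + 1`, `e(2^J + 1) ≥ l^{−J}·e(2)`: a polynomial floor of order
`log₂ l` (`= θ` for `l = 2^θ`), the exact complement of `RateBeyond θ`. [cite: LottiRomani1983, §1–§2] -/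
theorem excess_two_pos_of_transport_of_two_lt_omega {l : ℝ} (hl : 0 ≤ l)
    (hT : ∀ m : ℝ, 1 < m →
      omegaRect K 1 m 1 - (m + 1) ≤ l * (omegaRect K 1 (2 * m - 1) 1 - 2 * m))
    (hω : 2 < omega K) : 0 < omegaRect K 1 2 1 - (2 + 1) := by
  by_contra h
  rw [not_lt] at h
  have := omega_eq_two_of_transport_of_excess_two_nonpos K hl hT h
  linarith

/-- The grid floor itself: `e(2) ≤ l^J · e(2^J + 1)`. [cite: LottiRomani1983, §2 (p. 174)] -/
theorem excess_two_le_pow_mul_excess_grid {l : ℝ} (hl : 0 ≤ l)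
    (hT : ∀ m : ℝ, 1 < m →
      omegaRect K 1 m 1 - (m + 1) ≤ l * (omegaRect K 1 (2 * m - 1) 1 - 2 * m))
    (J : ℕ) :
    omegaRect K 1 2 1 - (2 + 1) ≤
      l ^ J * (omegaRect K 1 ((2 ^ J + 1 : ℕ) : ℝ) 1 - (((2 ^ J + 1 : ℕ) : ℝ) + 1)) := by
  have hk1 : (1 : ℝ) < ((2 ^ J + 1 : ℕ) : ℝ) := by
    push_cast; linarith [pow_pos (two_pos : (0 : ℝ) < 2) J]
  have hd := transport_descent K hl hT hk1 J
  have e : 1 + (((2 ^ J + 1 : ℕ) : ℝ) - 1) / 2 ^ J = 2 := by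
    push_cast; field_simp; ring
  rwa [e] at hd

/-! ## §5 Worlds: each piece is strictly weaker than the summit, and the pieces are independent -/

/-- **Power world** `E(x) = c·x^{−θ}` (`c > 0`, `θ ≥ 0`): it obeys the transport law with factor `2^θ`, has
`E(1) = c ≠ 0` (the summit's analogue `E ≡ 0` fails) and violates EVERY rate beyond `θ`.  So `SquareTransport θ`
does not carry `RateBeyond θ`, and is not summit-strength in any world with excess of exact order `θ`. [folklore] -/
theorem world_power (c θ : ℝ) (hc : 0 < c) (hθ : 0 ≤ θ) :
    (∀ m : ℝ, 1 < m → c * m ^ (-θ) ≤ (2 : ℝ) ^ θ * (c * (2 * m - 1) ^ (-θ))) ∧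
      c * (1 : ℝ) ^ (-θ) = c ∧
      ¬ ∃ δ C : ℝ, θ < δ ∧ ∀ k : ℕ, 1 ≤ k → c * (k : ℝ) ^ (-θ) ≤ C * (k : ℝ) ^ (-δ) := by
  refine ⟨fun m hm => ?_, by rw [Real.one_rpow, mul_one], ?_⟩
  · have hm0 : 0 < m := by linarith
    have h1 : (2 * m) ^ (-θ) ≤ (2 * m - 1) ^ (-θ) :=
      Real.rpow_le_rpow_of_nonpos (by linarith) (by linarith) (by linarith)
    have h2 : (2 * m) ^ (-θ) = (2 : ℝ) ^ (-θ) * m ^ (-θ) := Real.mul_rpow zero_le_two hm0.le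
    have h3 : (2 : ℝ) ^ θ * (2 : ℝ) ^ (-θ) = 1 := by
      rw [Real.rpow_neg zero_le_two, mul_inv_cancel₀ (Real.rpow_pos_of_pos two_pos θ).ne']
    have h2θ : 0 ≤ (2 : ℝ) ^ θ := Real.rpow_nonneg zero_le_two θ
    calc c * m ^ (-θ) = (2 : ℝ) ^ θ * (c * ((2 : ℝ) ^ (-θ) * m ^ (-θ))) := by
          rw [show (2 : ℝ) ^ θ * (c * ((2 : ℝ) ^ (-θ) * m ^ (-θ))) =
            ((2 : ℝ) ^ θ * (2 : ℝ) ^ (-θ)) * (c * m ^ (-θ)) by ring, h3, one_mul]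
      _ ≤ (2 : ℝ) ^ θ * (c * (2 * m - 1) ^ (-θ)) := by
          rw [← h2]
          exact mul_le_mul_of_nonneg_left (mul_le_mul_of_nonneg_left h1 hc.le) h2θ
  · rintro ⟨δ, C, hθδ, h⟩
    have hlim : Tendsto (fun k : ℕ => C * (k : ℝ) ^ (-(δ - θ))) atTop (𝓝 (C * 0)) :=
      ((tendsto_rpow_neg_atTop (by linarith : 0 < δ - θ)).comp tendsto_natCast_atTop_atTop).const_mul C
    rw [mul_zero] at hlim
    obtain ⟨k, hk, hk1⟩ := ((hlim.eventually (Iio_mem_nhds hc)).and (eventually_ge_atTop 1)).exists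
    have hk0 : (0 : ℝ) < k := by exact_mod_cast (by omega : 0 < k)
    have hkθ : 0 < (k : ℝ) ^ θ := Real.rpow_pos_of_pos hk0 θ
    have h' := mul_le_mul_of_nonneg_right (h k hk1) hkθ.le
    rw [mul_assoc, mul_assoc, ← Real.rpow_add hk0, ← Real.rpow_add hk0, neg_add_cancel, Real.rpow_zero,
      mul_one, show -δ + θ = -(δ - θ) by ring] at h'
    exact absurd h' (not_le.2 hk)

/-- **Kink world** `E(x) = max 0 (c(2 − x))` (`c > 0`; the profile of a finitely saturated excess): it obeys every
rate law (`E(k) = 0` for integers `k ≥ 2`), has `E(1) = c ≠ 0`, and violates the transport law for EVERY factor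
(`E(3/2) = c/2 > 0 = E(2)`).  So `RateBeyond θ` does not carry `SquareTransport θ` and is not summit-strength.
[folklore] -/
theorem world_kink (c θ : ℝ) (hc : 0 < c) :
    (∃ δ C : ℝ, θ < δ ∧ ∀ k : ℕ, 1 ≤ k → max 0 (c * (2 - (k : ℝ))) ≤ C * (k : ℝ) ^ (-δ)) ∧
      max 0 (c * (2 - (1 : ℝ))) = c ∧
      ¬ ∀ m : ℝ, 1 < m →
        max 0 (c * (2 - m)) ≤ (2 : ℝ) ^ θ * max 0 (c * (2 - (2 * m - 1))) := by
  refine ⟨⟨θ + 1, c, by linarith, fun k hk => ?_⟩, by rw [max_eq_right (by linarith)]; ring, fun h => ?_⟩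
  · rcases Nat.lt_or_ge k 2 with hk2 | hk2
    · obtain rfl : k = 1 := by omega
      have e : max 0 (c * (2 - ((1 : ℕ) : ℝ))) = c := by
        rw [max_eq_right (by push_cast; linarith)]; push_cast; ring
      rw [e, Nat.cast_one, Real.one_rpow, mul_one]
    · have hk2' : (2 : ℝ) ≤ k := by exact_mod_cast hk2
      rw [max_eq_left (by nlinarith)]
      exact mul_nonneg hc.le (Real.rpow_nonneg (by linarith) _)
  · have h32 := h (3 / 2) (by norm_num)
    have e1 : max 0 (c * (2 - (3 / 2 : ℝ))) = c / 2 := by rw [max_eq_right (by linarith)]; ring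
    have e2 : max 0 (c * (2 - (2 * (3 / 2 : ℝ) - 1))) = 0 := by norm_num
    rw [e1, e2, mul_zero] at h32
    linarith

end Summit.MatrixMultiplication.MatrixMultiplication.Theorems.FarEdgeDescentRateTransportDial

end
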